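import Mathlib
import Summits.CriticalPhenomena.PercolationContinuityZ3.Theorems.PercNearOneGluingNoHeavyLowerTailFatMinorityRestrictedLemma3
import Summits.CriticalPhenomena.PercolationContinuityZ3.Theorems.PercNearOneGluingNoHeavyLowerTailFatMinorityUpsetPostFKG
import Summits.CriticalPhenomena.PercolationContinuityZ3.Theorems.PercNearOneGluingNoHeavyLowerTailFatMinorityLayerCake
import Summits.CriticalPhenomena.PercolationContinuityZ3.Theorems.PercNearOneGluingNoHeavyLowerTailStarPatternForcing
import Summits.CriticalPhenomena.PercolationContinuityZ3.Theorems.PercNearOneGluingNoHeavyLowerTailFatMinorityGlueSeparation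
import HarnessLib

/-!
# `NoHeavyLowerTail` (stmt-CriticalPhenomena-4575), line fat-minority-linear — THEOREM C of the notes:
# the up-set Theorem 4 (UT4) on every up-set implies the RESTRICTED Theorem 4 (RT4) for every
# decreasing cluster event (route task `nh-dp-fatminority`, gen 11)

`μ = prodBernoulli w` on the pairs of `Fin n`; `o` an observer whose positive-weight pairs go to `A` (`o ∉ A`,
no loop at `o`); `c, b` further vertices; `Q` a decreasing event determined by the open edge cluster of `c`;
for an up-set `𝒰 ⊆ 𝒫(A)`, `U_𝒰 = {ω | ∃ B ∈ 𝒰, ∀ u ∈ B, s(o,u) ∈ ω}`.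

* UT4(𝒰): `μ({c↔b} ∩ U_𝒰) ≤ μ({o↔b} ∩ U_𝒰)`  (Kozma–Nitzan's Theorem 4 is `𝒰 = 𝒫(A) ∖ {∅}`).
* RT4(Q): `μ({c↔b} ∩ Q ∩ {o attached}) ≤ μ({o↔b} ∩ Q)`.

`rt4_of_ut4`: UT4 for every up-set `𝒰 ∌ ∅` implies RT4 for every decreasing `C_c`-event `Q`
(PROOF-UT4-upto3ports.md, THEOREM C).  Proof: on each star `σ_B` the law is the forced product measure
`μ_B` (`UpsetExchange.real_inter_starEvent_eq_mul_forced`); the signed restricted Lemma 3 (`restrictedLemma3`,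
BHK Thm 1.5 twice) in `μ_B` gives `H^Q(B) ≤ κ(B) · H(B)` with `κ(B) = μ_B(Q | c ↮ o)`; `κ` is monotone in `B`
(gluing more ports only separates `c` further from the blob: BHK Thm 1.1 `BHK2006_twoSeparationSets` in `μ_B`,
after pulling `μ_{B'}` back to `μ_B` along `ω ↦ ω ∪ {s(o,u) : u ∈ B' ∖ B}`); and the finite layer cake
(`upsetLayerCake_sum_nonpos`) turns `Σ_B κ(B) H(B)` into up-set sums, each `≤ 0` by UT4.  No definitions.
-/

namespace Summit.CriticalPhenomena.PercolationContinuityZ3.Theorems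

open MeasureTheory Set
open Literature.Probability.LatticeModels (prodBernoulli)
open Literature.Probability.Percolation

noncomputable section
open scoped Classical

variable {n : ℕ}

/-! ### 3. One cell: the signed restricted Lemma 3 in the forced measure -/

/-- Off `{c ↮ o}` the events `{c ↔ b}`, `{o ↔ b}` coincide; hence if `{c ↮ o}` is null then
`μ({c↔b} ∩ F) = μ({o↔b} ∩ F)` for every `F`. [folklore] -/
theorem real_openConn_inter_eq_of_notConn_null (μ : Measure (BondConfig (Fin n))) [IsFiniteMeasure μ]
    (c o b : Fin n) (F : Set (BondConfig (Fin n))) (h0 : μ.real (openConn c o)ᶜ = 0) :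
    μ.real (openConn c b ∩ F) = μ.real (openConn o b ∩ F) := by
  have hDm : MeasurableSet ((openConn c o)ᶜ : Set (BondConfig (Fin n))) := MeasurableSet.of_discrete
  have hs1 := measureReal_inter_add_sdiff (μ := μ) (s := openConn c b ∩ F) hDm
  have hs2 := measureReal_inter_add_sdiff (μ := μ) (s := openConn o b ∩ F) hDm
  have hz1 : μ.real (openConn c b ∩ F ∩ (openConn c o)ᶜ) = 0 :=
    le_antisymm ((measureReal_mono inter_subset_right).trans h0.le) measureReal_nonneg
  have hz2 : μ.real (openConn o b ∩ F ∩ (openConn c o)ᶜ) = 0 :=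
    le_antisymm ((measureReal_mono inter_subset_right).trans h0.le) measureReal_nonneg
  have hagree : (openConn c b ∩ F) \ (openConn c o)ᶜ = (openConn o b ∩ F) \ (openConn c o)ᶜ := by
    ext ω
    simp only [mem_sdiff, mem_inter_iff, mem_compl_iff, not_not, openConn, mem_setOf_eq]
    constructor
    · rintro ⟨⟨h1, hF⟩, h2⟩
      exact ⟨⟨h2.symm.trans h1, hF⟩, h2⟩
    · rintro ⟨⟨h1, hF⟩, h2⟩
      exact ⟨⟨h2.trans h1, hF⟩, h2⟩
  rw [hagree] at hs1
  linarith

/-- **The cell comparison `H^Q(B) ≤ κ(B) · H(B)`.**  Let `σ` be an event on which `μ_w` is `μ_w(σ)` times a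
product law `μ_W` (for a star pattern `σ_B` this is `UpsetExchange.real_inter_starEvent_eq_mul_forced`), and `Q` a
decreasing `C_c`-event.  With `D = {c ↮ o}` and `κ = μ_W(D ∩ Q)/μ_W(D)` (`κ = 1` if `μ_W(D) = 0`):
`μ({c↔b} ∩ Q ∩ σ) − μ({o↔b} ∩ Q ∩ σ) ≤ κ · (μ({c↔b} ∩ σ) − μ({o↔b} ∩ σ))`, by the signed restricted Lemma 3
(`restrictedLemma3`, BHK Thm 1.5 twice) in `μ_W`. [cite: VandenbergHaggstromKahn2005, Thm. 1.5 (p. 7); KozmaNitzan2024, Lemma 3 p. 6] -/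
theorem cell_restricted_le (w W : Sym2 (Fin n) → unitInterval) (o c b : Fin n) (σ : Set (BondConfig (Fin n)))
    (hforce : ∀ X : Set (BondConfig (Fin n)),
      (prodBernoulli w).real (X ∩ σ) = (prodBernoulli w).real σ * (prodBernoulli W).real X)
    (Q : Set (BondConfig (Fin n)))
    (hQ : ∀ ω ω', ω ∈ Q → openEdgeCluster ω' c ⊆ openEdgeCluster ω c → ω' ∈ Q) :
    (prodBernoulli w).real (openConn c b ∩ Q ∩ σ) - (prodBernoulli w).real (openConn o b ∩ Q ∩ σ) ≤
      (if (prodBernoulli W).real (openConn c o)ᶜ = 0 then 1 else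
          (prodBernoulli W).real ((openConn c o)ᶜ ∩ Q) / (prodBernoulli W).real (openConn c o)ᶜ) *
        ((prodBernoulli w).real (openConn c b ∩ σ) - (prodBernoulli w).real (openConn o b ∩ σ)) := by
  rw [hforce, hforce, hforce, hforce]
  have hσ : 0 ≤ (prodBernoulli w).real σ := measureReal_nonneg
  split_ifs with h0
  · -- null separation: both brackets vanish
    rw [real_openConn_inter_eq_of_notConn_null (prodBernoulli W) c o b Q h0]
    have h' := real_openConn_inter_eq_of_notConn_null (prodBernoulli W) c o b univ h0
    simp only [inter_univ] at h'
    rw [h']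
    linarith
  · have hpos : 0 < (prodBernoulli W).real (openConn c o)ᶜ := lt_of_le_of_ne measureReal_nonneg (Ne.symm h0)
    have hL := restrictedLemma3 W c o b univ Q (fun _ _ _ _ => mem_univ _) hQ
    simp only [univ_inter] at hL
    rw [show (prodBernoulli w).real σ * (prodBernoulli W).real (openConn c b ∩ Q) -
          (prodBernoulli w).real σ * (prodBernoulli W).real (openConn o b ∩ Q) =
        (prodBernoulli w).real σ *
          ((prodBernoulli W).real (openConn c b ∩ Q) - (prodBernoulli W).real (openConn o b ∩ Q)) by ring,
      show (prodBernoulli W).real ((openConn c o)ᶜ ∩ Q) / (prodBernoulli W).real (openConn c o)ᶜ *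
          ((prodBernoulli w).real σ * (prodBernoulli W).real (openConn c b) -
            (prodBernoulli w).real σ * (prodBernoulli W).real (openConn o b)) =
        (prodBernoulli w).real σ *
          ((prodBernoulli W).real ((openConn c o)ᶜ ∩ Q) / (prodBernoulli W).real (openConn c o)ᶜ *
            ((prodBernoulli W).real (openConn c b) - (prodBernoulli W).real (openConn o b))) by ring]
    refine mul_le_mul_of_nonneg_left ?_ hσ
    rw [div_mul_eq_mul_div, le_div_iff₀ hpos]
    nlinarith [hL]

/-! ### 4. THEOREM C: UT4 on every up-set ⟹ RT4 for every decreasing cluster event -/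

/-- **THEOREM C** (`UT4 ⟹ RT4`).  Let `o ∉ A` be an observer whose positive-weight pairs go to `A` (no loop at
`o`), `c, b` vertices, and `Q` a decreasing event determined by the open edge cluster of `c`.  If for EVERY
up-set `𝒰 ⊆ 𝒫(A)` with `∅ ∉ 𝒰` the up-set Theorem-4 inequality `μ({c↔b} ∩ U_𝒰) ≤ μ({o↔b} ∩ U_𝒰)` holds, then
`μ({c↔b} ∩ Q ∩ {o attached}) ≤ μ({o↔b} ∩ Q)` — Kozma–Nitzan's Theorem 4 RESTRICTED to `Q`.  Proof: cells
(`cell_restricted_le`), monotonicity of `κ(B) = μ_B(Q | c ↮ o)` in the pattern `B` (`glueStar_real_notConn`,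
`notConn_condProb_mono`), and the layer cake `upsetLayerCake_sum_nonpos`, whose up-set sums are the hypothesis.
[cite: KozmaNitzan2024, Thm. 4 (p. 13) and Lemma 3 (p. 6); VandenbergHaggstromKahn2005, Thm. 1.1 (p. 3), Thm. 1.5 (p. 7); combination: route notes gen 8 (THEOREM C)] -/
theorem rt4_of_ut4 (w : Sym2 (Fin n) → unitInterval) (A : Finset (Fin n)) (o c b : Fin n)
    (hoA : o ∉ A) (hiso : ∀ u, u ≠ o → u ∉ A → w s(o, u) = 0) (hloop : w s(o, o) = 0)
    (Q : Set (BondConfig (Fin n)))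
    (hQ : ∀ ω ω', ω ∈ Q → openEdgeCluster ω' c ⊆ openEdgeCluster ω c → ω' ∈ Q)
    (hUT4 : ∀ 𝒰 : Finset (Finset (Fin n)), 𝒰 ⊆ A.powerset → ∅ ∉ 𝒰 →
      (∀ B ∈ 𝒰, ∀ B' ∈ A.powerset, B ⊆ B' → B' ∈ 𝒰) →
      (prodBernoulli w).real (openConn c b ∩ {ω | ∃ B ∈ 𝒰, ∀ u ∈ B, s(o, u) ∈ ω}) ≤
        (prodBernoulli w).real (openConn o b ∩ {ω | ∃ B ∈ 𝒰, ∀ u ∈ B, s(o, u) ∈ ω})) :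
    (prodBernoulli w).real (openConn c b ∩ Q ∩ {ω | ∃ u ∈ A, s(o, u) ∈ ω}) ≤
      (prodBernoulli w).real (openConn o b ∩ Q) := by
  set 𝒜 : Finset (Finset (Fin n)) := A.powerset.erase ∅ with h𝒜
  have h𝒜A : 𝒜 ⊆ A.powerset := Finset.erase_subset _ _
  have h𝒜up : ∀ B ∈ 𝒜, ∀ B' ∈ A.powerset, B ⊆ B' → B' ∈ 𝒜 := by
    intro B hB B' hB' hBB'
    refine Finset.mem_erase.2 ⟨?_, hB'⟩
    rintro rfl
    exact (Finset.mem_erase.1 hB).1 (Finset.subset_empty.1 hBB')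
  -- the attachment event is `U_𝒜`
  have hatt : {ω : BondConfig (Fin n) | ∃ u ∈ A, s(o, u) ∈ ω} =
      {ω | ∃ B ∈ 𝒜, ∀ u ∈ B, s(o, u) ∈ ω} := by
    ext ω
    simp only [mem_setOf_eq]
    constructor
    · rintro ⟨u, huA, hu⟩
      refine ⟨{u}, Finset.mem_erase.2 ⟨Finset.singleton_ne_empty u,
        Finset.mem_powerset.2 (Finset.singleton_subset_iff.2 huA)⟩, fun v hv => ?_⟩
      rw [Finset.mem_singleton.1 hv]
      exact hu
    · rintro ⟨B, hB, hop⟩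
      obtain ⟨hBne, hBA⟩ := Finset.mem_erase.1 hB
      obtain ⟨u, hu⟩ := Finset.nonempty_of_ne_empty hBne
      exact ⟨u, Finset.mem_powerset.1 hBA hu, hop u hu⟩
  -- the forced measures on the cells
  have hforce : ∀ B ∈ 𝒜, ∀ X : Set (BondConfig (Fin n)),
      (prodBernoulli w).real (X ∩ starEvent o (↑B : Set (Fin n))) =
        (prodBernoulli w).real (starEvent o (↑B : Set (Fin n))) *
          (prodBernoulli (fun e : Sym2 (Fin n) =>
            if o ∈ e then (if ∃ p ∈ B, e = s(o, p) then 1 else 0) else w e)).real X := by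
    intro B hB X
    have hoB : o ∉ B := fun h => hoA (Finset.mem_powerset.1 (h𝒜A hB) h)
    exact UpsetExchange.real_inter_starEvent_eq_mul_forced w o B hoB hloop X
  set κ : Finset (Fin n) → ℝ := fun B =>
    if (prodBernoulli (fun e : Sym2 (Fin n) =>
          if o ∈ e then (if ∃ p ∈ B, e = s(o, p) then 1 else 0) else w e)).real (openConn c o)ᶜ = 0
      then 1 else
      (prodBernoulli (fun e : Sym2 (Fin n) =>
          if o ∈ e then (if ∃ p ∈ B, e = s(o, p) then 1 else 0) else w e)).real ((openConn c o)ᶜ ∩ Q) /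
        (prodBernoulli (fun e : Sym2 (Fin n) =>
          if o ∈ e then (if ∃ p ∈ B, e = s(o, p) then 1 else 0) else w e)).real (openConn c o)ᶜ
    with hκ
  set H : Finset (Fin n) → ℝ := fun B =>
    (prodBernoulli w).real (openConn c b ∩ starEvent o (↑B : Set (Fin n))) -
      (prodBernoulli w).real (openConn o b ∩ starEvent o (↑B : Set (Fin n))) with hH
  -- (1) the cells
  have hcell : ∀ B ∈ 𝒜,
      (prodBernoulli w).real (openConn c b ∩ Q ∩ starEvent o (↑B : Set (Fin n))) -
        (prodBernoulli w).real (openConn o b ∩ Q ∩ starEvent o (↑B : Set (Fin n))) ≤ κ B * H B := by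
    intro B hB
    have h := cell_restricted_le w _ o c b (starEvent o (↑B : Set (Fin n))) (hforce B hB) Q hQ
    simpa only [hκ, hH] using h
  -- (2) `κ ≥ 0` and monotone
  have hκ0 : ∀ B ∈ 𝒜, 0 ≤ κ B := by
    intro B _
    simp only [hκ]
    split_ifs
    · exact zero_le_one
    · exact div_nonneg measureReal_nonneg measureReal_nonneg
  have hκmono : ∀ B ∈ 𝒜, ∀ B' ∈ 𝒜, B ⊆ B' → κ B ≤ κ B' := by
    intro B hB B' hB' hBB'
    set W₁ : Sym2 (Fin n) → unitInterval := fun e =>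
      if o ∈ e then (if ∃ p ∈ B, e = s(o, p) then 1 else 0) else w e with hW₁
    set W₂ : Sym2 (Fin n) → unitInterval := fun e =>
      if o ∈ e then (if ∃ p ∈ B', e = s(o, p) then 1 else 0) else w e with hW₂
    set T : Finset (Fin n) := B' \ B with hT
    have h1 : ∀ e ∈ ({e | ∃ u ∈ T, e = s(o, u)} : Set (Sym2 (Fin n))), W₂ e = 1 := by
      rintro e ⟨u, hu, rfl⟩
      have huB' : u ∈ B' := (Finset.mem_sdiff.1 hu).1
      have hoe : o ∈ s(o, u) := Sym2.mem_mk_left o u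
      simp only [hW₂, if_pos hoe]
      rw [if_pos ⟨u, huB', rfl⟩]
    have h2 : ∀ e ∉ ({e | ∃ u ∈ T, e = s(o, u)} : Set (Sym2 (Fin n))), W₂ e = W₁ e := by
      intro e he
      by_cases hoe : o ∈ e
      · have hiff : (∃ p ∈ B', e = s(o, p)) ↔ (∃ p ∈ B, e = s(o, p)) := by
          constructor
          · rintro ⟨p, hp, rfl⟩
            by_cases hpB : p ∈ B
            · exact ⟨p, hpB, rfl⟩
            · exact (he ⟨p, Finset.mem_sdiff.2 ⟨hp, hpB⟩, rfl⟩).elim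
          · rintro ⟨p, hp, rfl⟩
            exact ⟨p, hBB' hp, rfl⟩
        simp only [hW₁, hW₂, if_pos hoe, hiff]
      · simp only [hW₁, hW₂, if_neg hoe]
    obtain ⟨hD, hDQ⟩ := glueStar_real_notConn W₁ W₂ o c T h1 h2 Q hQ
    have hmono := notConn_condProb_mono W₁ o c T Q hQ
    show (if (prodBernoulli W₁).real (openConn c o)ᶜ = 0 then (1 : ℝ) else
        (prodBernoulli W₁).real ((openConn c o)ᶜ ∩ Q) / (prodBernoulli W₁).real (openConn c o)ᶜ) ≤
      (if (prodBernoulli W₂).real (openConn c o)ᶜ = 0 then (1 : ℝ) else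
        (prodBernoulli W₂).real ((openConn c o)ᶜ ∩ Q) / (prodBernoulli W₂).real (openConn c o)ᶜ)
    rw [hD, hDQ]
    by_cases h2z : (prodBernoulli W₁).real
        ((openConn c o)ᶜ ∩ {ω | ∀ u ∈ T, ¬ (openGraph ω).Reachable c u}) = 0
    · rw [if_pos h2z]
      split_ifs
      · exact le_refl _
      · exact div_le_one_of_le₀ (measureReal_mono inter_subset_left) measureReal_nonneg
    · rw [if_neg h2z]
      have hNpos : 0 < (prodBernoulli W₁).real
          ((openConn c o)ᶜ ∩ {ω | ∀ u ∈ T, ¬ (openGraph ω).Reachable c u}) :=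
        lt_of_le_of_ne measureReal_nonneg (Ne.symm h2z)
      have hDpos : 0 < (prodBernoulli W₁).real (openConn c o)ᶜ :=
        lt_of_lt_of_le hNpos (measureReal_mono inter_subset_left)
      rw [if_neg hDpos.ne', div_le_div_iff₀ hDpos hNpos]
      exact hmono
  -- (3) up-set sums of `H` are nonpositive (the hypothesis UT4)
  have hHsum : ∀ 𝒰 ⊆ 𝒜, (∀ B ∈ 𝒰, ∀ B' ∈ 𝒜, B ⊆ B' → B' ∈ 𝒰) → ∑ B ∈ 𝒰, H B ≤ 0 := by
    intro 𝒰 h𝒰 hup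
    have h𝒰A : 𝒰 ⊆ A.powerset := h𝒰.trans h𝒜A
    have h0 : ∅ ∉ 𝒰 := fun h => (Finset.mem_erase.1 (h𝒰 h)).1 rfl
    have hup' : ∀ B ∈ 𝒰, ∀ B' ∈ A.powerset, B ⊆ B' → B' ∈ 𝒰 :=
      fun B hB B' hB' hBB' => hup B hB B' (h𝒜up B (h𝒰 hB) B' hB' hBB') hBB'
    have h := hUT4 𝒰 h𝒰A h0 hup'
    rw [real_inter_starUpEvent_eq_sum w A o hoA hiso 𝒰 h𝒰A hup' (openConn c b),
      real_inter_starUpEvent_eq_sum w A o hoA hiso 𝒰 h𝒰A hup' (openConn o b)] at h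
    simp only [hH]
    rw [Finset.sum_sub_distrib]
    linarith
  -- (4) assemble
  have hLHS : (prodBernoulli w).real (openConn c b ∩ Q ∩ {ω | ∃ u ∈ A, s(o, u) ∈ ω}) =
      ∑ B ∈ 𝒜, (prodBernoulli w).real (openConn c b ∩ Q ∩ starEvent o (↑B : Set (Fin n))) := by
    rw [hatt]
    exact real_inter_starUpEvent_eq_sum w A o hoA hiso 𝒜 h𝒜A h𝒜up (openConn c b ∩ Q)
  have hRHS : ∑ B ∈ 𝒜, (prodBernoulli w).real (openConn o b ∩ Q ∩ starEvent o (↑B : Set (Fin n))) ≤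
      (prodBernoulli w).real (openConn o b ∩ Q) := by
    rw [← real_inter_starUpEvent_eq_sum w A o hoA hiso 𝒜 h𝒜A h𝒜up (openConn o b ∩ Q)]
    exact measureReal_mono inter_subset_left
  have hsum : ∑ B ∈ 𝒜, ((prodBernoulli w).real (openConn c b ∩ Q ∩ starEvent o (↑B : Set (Fin n))) -
      (prodBernoulli w).real (openConn o b ∩ Q ∩ starEvent o (↑B : Set (Fin n)))) ≤
      ∑ B ∈ 𝒜, κ B * H B :=
    Finset.sum_le_sum hcell
  have hcake := upsetLayerCake_sum_nonpos 𝒜 H κ hκ0 hκmono hHsum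
  rw [Finset.sum_sub_distrib] at hsum
  linarith

end

end Summit.CriticalPhenomena.PercolationContinuityZ3.Theorems
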